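import Literature.Probability.RandomPlanarGeometry.SLESwallowedRealPoints
import Literature.Probability.RandomPlanarGeometry.CritPercSLESwallowingProofs
import Literature.Probability.RandomPlanarGeometry.CritPercSLELocalityMartingaleProofs
import HarnessLib

/-!
# Swallowed points of SLE_κ, `4 < κ < 8` (Rohde–Schramm's Thm 6.4): assembly without trace existence

Topic `Probability/RandomPlanarGeometry`; theorems only. Proof sibling of `CritPercSLE.lean` for the
named fact `Literature.Probability.RandomPlanarGeometry.ae_isSwallowed_sleTrace` (S. Rohde, O. Schramm,
*Basic properties of SLE*, Ann. of Math. 161 (2005), **Thm 6.4**, first half: for `κ ∈ (4, 8)` and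
`z ∈ closure ℍ ∖ {0}`, almost surely `z ∉ γ[0, ∞)` and `τ(z) < ∞`).

`CritPercSLESwallowing.ae_isSwallowed_sleTrace_of_lemmas` reduced the fact to four inputs: existence
of the trace (Thm 5.1), Lemma 6.5 (`τ(z) < ∞`), Lemma 6.3 for `κ < 8`, and the first-hit
consequence of Lemma 6.6. Two of these are now theorems of the tree
(`exists_tendsto_sleDerivRatio_of_lt_eight_holds`, `ae_sleTrace_firstHit_realRay_ne_holds`), and the
existence of the trace is not needed at all, by the junk convention of `Loewner.trace` (on a sample
path whose chain is not generated by a curve the trace is the constant `0`, see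
`CritPercSLESelfTouching.ae_notMem_range_sleTrace_of_lemma63` and
`SLESwallowedRealPoints.ae_ofReal_notMem_range_sleTrace`). This file records what is left:

* `ae_sle_swallowingTime_ofReal_lt_top` — **every real `x ≠ 0` is a.s. swallowed for `κ > 4`**
  (the real-point case of Lemma 6.5, unconditional): `T_1 < ∞` a.s. from Lawler's one-point
  martingales (`sle_swallowingTime_lt_top_of_onePointMartingales`, proved Itô steps), and
  `P[T_x < ∞]` does not depend on `x ≠ 0` (scaling and reflection,
  `measure_sle_swallowingTime_lt_top_eq`);
* `ae_notMem_range_sleTrace` — **a fixed `z ∈ closure ℍ ∖ {0}` is a.s. not on the trace,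
  `4 < κ < 8`** (interior points: Lemma 6.3 and Koebe, `ae_notMem_range_sleTrace_of_lt_eight`;
  real points: `ae_ofReal_notMem_range_sleTrace`);
* `ae_isSwallowed_sleTrace_of_interior` — the fact follows from the interior-point case of
  Lemma 6.5 alone (for `4 < κ < 8` and `z ∈ ℍ`, a.s. `τ(z) < ∞`), and
  `ae_isSwallowed_sleTrace_of_lemma65` — from the named fact
  `ae_swallowingTime_lt_top_of_four_lt` (Lemma 6.5 as printed) alone.

## References

* S. Rohde, O. Schramm, *Basic properties of SLE*, Ann. of Math. 161 (2005), Thm 6.4 and its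
  proof (pp. 906, 908), Lemma 6.5.
* G. F. Lawler, *Conformally Invariant Processes in the Plane*, AMS (2005), Prop. 6.8, §6.7.
-/

noncomputable section

open MeasureTheory ProbabilityTheory Filter Set
open scoped NNReal ENNReal

namespace Literature.Probability.RandomPlanarGeometry

open Loewner Literature.Probability.Process

variable {κ : ℝ≥0}

/-! ### Real points are a.s. swallowed for `κ > 4` -/

/-- **Every real point `x ≠ 0` is a.s. swallowed by SLE_κ, `κ > 4`** (Rohde–Schramm (2005),
Lemma 6.5, real-point case; Lawler (2005), Prop. 6.8): `T_1 < ∞` a.s. by the one-point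
martingales (`sle_swallowingTime_lt_top_of_onePointMartingales` with the proved Itô steps
`sle_martingale_onePointPow_holds`, `sle_martingale_onePointSq_holds`), and
`P[T_x < ∞] = P[T_1 < ∞]` for every real `x ≠ 0` (`measure_sle_swallowingTime_lt_top_eq`, Brownian
scaling and reflection). [cite: RohdeSchramm2005, Lemma 6.5] -/
theorem ae_sle_swallowingTime_ofReal_lt_top (hκ4 : 4 < κ) {x : ℝ} (hx : x ≠ 0) :
    ∀ᵐ ω ∂preWienerMeasure, swallowingTime (sleDriving κ ω) x < ⊤ := by
  have h1 := sle_swallowingTime_lt_top_of_onePointMartingales sle_martingale_onePointPow_holds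
    sle_martingale_onePointSq_holds hκ4 (show (0 : ℝ) < 1 from one_pos)
  rw [ae_iff] at h1 ⊢
  have hset : ∀ u : ℝ, {ω : ℝ≥0 → ℝ | ¬ swallowingTime (sleDriving κ ω) u < ⊤} =
      {ω | swallowingTime (sleDriving κ ω) u < ⊤}ᶜ := fun u ↦ rfl
  haveI := isProbabilityMeasure_preWienerMeasure'
  rw [hset, measure_compl (measurableSet_sle_swallowingTime_lt_top κ hx) (measure_ne_top _ _),
    measure_sle_swallowingTime_lt_top_eq κ hx one_ne_zero,
    ← measure_compl (measurableSet_sle_swallowingTime_lt_top κ one_ne_zero) (measure_ne_top _ _)]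
  simpa only [hset] using h1

/-! ### A fixed point of the closed half-plane is a.s. not on the trace, `4 < κ < 8` -/

/-- **A fixed `z ∈ closure ℍ ∖ {0}` is a.s. not on the SLE_κ trace, `4 < κ < 8`**
(Rohde–Schramm (2005), Thm 6.4, "`z ∉ γ[0, ∞)`"; §1 p. 885: "for every `z ∈ closure ℍ` a.s.
`z ∉ γ[0, ∞)`"): interior points by Lemma 6.3 and the Koebe argument
(`ae_notMem_range_sleTrace_of_lt_eight`), real points by the same-side swallowing estimate
(`ae_ofReal_notMem_range_sleTrace`). No trace-existence hypothesis (junk trace off curves).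
[cite: RohdeSchramm2005, Thm 6.4] -/
theorem ae_notMem_range_sleTrace (hκ4 : 4 < κ) (hκ8 : κ < 8) {z : ℂ} (hzim : 0 ≤ z.im)
    (hz0 : z ≠ 0) : ∀ᵐ ω ∂preWienerMeasure, z ∉ range (sleTrace κ ω) := by
  rcases hzim.eq_or_lt with him | him
  · -- real point `z = x`, `x ≠ 0`
    have hre : z.re ≠ 0 := fun h ↦ hz0 (Complex.ext h him.symm)
    have hz : ((z.re : ℝ) : ℂ) = z := Complex.ext rfl (by rw [Complex.ofReal_im]; exact him)
    rw [← hz]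
    exact ae_ofReal_notMem_range_sleTrace hκ4 hκ8 hre
  · exact ae_notMem_range_sleTrace_of_lt_eight (lt_trans (by norm_num) hκ4) hκ8 him

/-! ### Assembly of Thm 6.4 (first half) -/

section CritPerc

/-- **Rohde–Schramm's Thm 6.4 (first half) from the interior-point case of Lemma 6.5**: if for
`4 < κ < 8` and every `z ∈ ℍ` almost surely `τ(z) < ∞` (hypothesis `hint`), then
`ae_isSwallowed_sleTrace` holds — real points are a.s. swallowed unconditionally
(`ae_sle_swallowingTime_ofReal_lt_top`) and no fixed point is on the trace
(`ae_notMem_range_sleTrace`). [cite: RohdeSchramm2005, Thm 6.4] -/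
theorem ae_isSwallowed_sleTrace_of_interior
    (hint : ∀ {κ : ℝ≥0}, 4 < κ → κ < 8 → ∀ {z : ℂ}, 0 < z.im →
      ∀ᵐ ω ∂preWienerMeasure, swallowingTime (sleDriving κ ω) z < ⊤) :
    ae_isSwallowed_sleTrace := by
  intro κ hκ hκ' z hzim hz0
  have hrange := ae_notMem_range_sleTrace hκ hκ' hzim hz0
  rcases hzim.eq_or_lt with him | him
  · have hre : z.re ≠ 0 := fun h ↦ hz0 (Complex.ext h him.symm)
    have hz : ((z.re : ℝ) : ℂ) = z := Complex.ext rfl (by rw [Complex.ofReal_im]; exact him)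
    have hT := ae_sle_swallowingTime_ofReal_lt_top hκ hre
    rw [hz] at hT
    filter_upwards [hrange, hT] with ω h₁ h₂
    exact ⟨h₁, h₂⟩
  · filter_upwards [hrange, hint hκ hκ' him] with ω h₁ h₂
    exact ⟨h₁, h₂⟩

/-- **Rohde–Schramm's Thm 6.4 (first half) from Lemma 6.5 alone**: the named fact
`ae_isSwallowed_sleTrace` follows from the named fact `ae_swallowingTime_lt_top_of_four_lt`
(Rohde–Schramm (2005), Lemma 6.5: `κ > 4`, `z ∈ closure ℍ ∖ {0}` ⇒ a.s. `τ(z) < ∞`, hypothesis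
`h65`); compared with `ae_isSwallowed_sleTrace_of_lemmas` the existence of the trace (Thm 5.1),
Lemma 6.3 and Lemma 6.6 are no longer hypotheses. [cite: RohdeSchramm2005, Thm 6.4] -/
theorem ae_isSwallowed_sleTrace_of_lemma65 (h65 : ae_swallowingTime_lt_top_of_four_lt) :
    ae_isSwallowed_sleTrace :=
  ae_isSwallowed_sleTrace_of_interior fun hκ _ _ him ↦ h65 hκ him.le fun h ↦ by
    rw [h, Complex.zero_im] at him
    exact lt_irrefl _ him

end CritPerc

end Literature.Probability.RandomPlanarGeometry
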